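import Summits.Langlands.Langlands.Theorems.IrreducibilityBySelfDualityPairLBoundaryJSCornerArchFactorData
import Literature.NumberTheory.Automorphic.ArchRankinSelbergGapTestVector

/-!
# The archimedean `GL_n × GL_m` data at a prescribed point with their reciprocal entire factor `Λ`

Summit `Langlands`, sub-problem `Langlands`, helper file under `Theorems/` supporting the crux
`PairLBoundaryJS` (stmt-Langlands-13622), line `Sketch`, registered sub-stub `stub_gap_arch_factor_data`
(G-AFD) of the stub `stub_gap_local_control` (G-LC) of the GAP ROAD (skeleton v19, lead c6): the
`GL_n × GL_m` (`m < n`) analogue of `CornerArchFactorData.exists_archCornerFactorData`. From the named fact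
`JacquetShalika1990_archRankinSelbergGap_entireRatio n m K`, clause (i) AT A GIVEN POINT `s₀` (Jacquet (2009),
Thm. 2.1 (i)(ii), Thm. 2.6 (i) with Prop. 12.5; Cogdell (2004), Thm. 3.5 and §4.2: finitely many
`K_∞`-finite Gårding data `e_i`, `e'_i`, an entire `h` with `h(s₀) ≠ 0` and
`Σ_i Ψ^{(n,m)}_∞(s; W_{e_i}, W̄'_{e'_i}) = h(s) · c^s ∏_j Γ_ℝ(s + a_j) ∏_j Γ_ℂ(s + b_j)` for `re s > x₀`) we
produce the ENTIRE reciprocal factor `Λ(s) = c^{-s} ∏_j Γ_ℝ(s + a_j)⁻¹ ∏_j Γ_ℂ(s + b_j)⁻¹`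
(`CornerArchFactorData.differentiable_archFactorInv`) and the abscissa
`x₁ = max x₀ (Σ_j ‖a_j‖ + Σ_j ‖b_j‖)`, to the right of which `Λ(s) · (c^s ∏ Γ_ℝ ∏ Γ_ℂ) = 1`
(`CornerArchFactorData.archFactorInv_mul_eq_one`), so that
`Λ(s) · Σ_i Ψ^{(n,m)}_∞(s; e_i, e'_i) = h(s)` there.

## References

* H. Jacquet, *Archimedean Rankin–Selberg integrals*, Contemp. Math. 489 (2009), Thm. 2.1 (i)(ii) (p. 6),
  Thm. 2.6 (i) (p. 9), Prop. 12.5 (p. 75) [JacquetArchimedeanRS2009].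
* J. W. Cogdell, *Analytic theory of L-functions for GL_n* (2004), Thm. 3.5, §4.1, §4.2
  [CogdellAnalyticTheory2004].
-/

noncomputable section

-- `Summit.Langlands.Langlands.…` (summit = sub-problem name, D-0017 layout) trips `dupNamespace`
set_option linter.dupNamespace false

open scoped MatrixGroups Topology Pointwise ENNReal NNReal ComplexConjugate InnerProductSpace ContDiff
-- the place subtypes indexing `mixedSpace K` are `Fintype` classically (`NormedCommRing (mixedSpace K)`)
open scoped Classical Matrix.Norms.Operator
open NumberField IsDedekindDomain MeasureTheory Measure Matrix Set Filter WithZero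
open NumberField.mixedEmbedding
open Literature.NumberTheory.Automorphic AdelicGroupData
open Literature.NumberTheory.GaloisRepresentations (ideleGroup HeckeCharacter)
open Literature.MeasureTheory.Group
open ValuativeRel

namespace Summit.Langlands.Langlands.Theorems.GapArchFactorData

open CornerArchFactorData

/-! ### The `GL_n × GL_m` data at a prescribed point -/

/-- **The archimedean `GL_n × GL_m` data at a prescribed point `s₀` with their reciprocal entire factor**
(the `GL_n × GL_m` analogue of `CornerArchFactorData.exists_archCornerFactorData`): granted
`JacquetShalika1990_archRankinSelbergGap_entireRatio n m K`, for `m < n`, irreducible unitary strongly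
continuous `τ` of `GL_n(K_∞)`, `τ'` of `GL_m(K_∞)` with non-zero continuous Whittaker functionals `ℓ`, `ℓ'`,
Haar measures `μA`, `μK` and any `s₀ ∈ ℂ`, there are finitely many `K_∞`-finite Gårding vectors `e_i`, `e'_i`,
ENTIRE `Λ`, `h` with `h(s₀) ≠ 0` and an abscissa `x₁` with
`Λ(s) · Σ_i Ψ^{(n,m)}_∞(s; W_{e_i}, W̄'_{e'_i}) = h(s)` for `re s > x₁`: take the data of clause (i) of the fact at
`s₀`, `Λ = c^{-s} ∏_j Γ_ℝ(s + a_j)⁻¹ ∏_j Γ_ℂ(s + b_j)⁻¹` and `x₁ = max x₀ (Σ_j ‖a_j‖ + Σ_j ‖b_j‖)`, so that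
`Λ · Σ_i Ψ_i = Λ · h · (c^s ∏ Γ) = h`.
[cite: JacquetArchimedeanRS2009, Thm. 2.1 (i)(ii) (p. 6), Thm. 2.6 (i) (p. 9), Prop. 12.5 (p. 75)]
[cite: CogdellAnalyticTheory2004, Thm. 3.5 (PDF p. 197) and §4.2 (PDF p. 202)] -/
theorem exists_archGapFactorData {n m : ℕ} {K : Type} [Field K] [NumberField K]
    (h : JacquetShalika1990_archRankinSelbergGap_entireRatio n m K) (hmn : m < n)
    (hcpt : isCompact_glFiniteIntegralLevel n K) (hcpt' : isCompact_glFiniteIntegralLevel m K)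
    (E : Type) [NormedAddCommGroup E] [InnerProductSpace ℂ E] [CompleteSpace E]
    (τ : ContRepresentation ℂ (AutomorphyDatum.gl n K hcpt).arch.carrier E) (hτ : τ.IsStronglyContinuous)
    (hτu : τ.IsUnitary) (hτi : τ.IsTopIrreducible)
    (ℓ : archGardingSpace hcpt τ →ₗ[ℂ] ℂ) (hℓ : IsArchContWhittakerFunctional hcpt τ hτ ℓ) (hℓ0 : ℓ ≠ 0)
    (E' : Type) [NormedAddCommGroup E'] [InnerProductSpace ℂ E'] [CompleteSpace E']
    (τ' : ContRepresentation ℂ (AutomorphyDatum.gl m K hcpt').arch.carrier E') (hτ' : τ'.IsStronglyContinuous)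
    (hτu' : τ'.IsUnitary) (hτi' : τ'.IsTopIrreducible)
    (ℓ' : archGardingSpace hcpt' τ' →ₗ[ℂ] ℂ) (hℓ' : IsArchContWhittakerFunctional hcpt' τ' hτ' ℓ') (hℓ'0 : ℓ' ≠ 0)
    [MeasurableSpace (GL (Fin m) (mixedSpace K))] [BorelSpace (GL (Fin m) (mixedSpace K))]
    [MeasurableSpace ((mixedSpace K)ˣ)] [BorelSpace ((mixedSpace K)ˣ)]
    (μA : Measure (Fin m → (mixedSpace K)ˣ)) (hμA : IsHaarMeasure μA)
    (μK : Measure ↥(Kinf m K)) (hμK : IsHaarMeasure μK) (s₀ : ℂ) :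
    ∃ (k : ℕ) (e : Fin k → archGardingSpace hcpt τ) (e' : Fin k → archGardingSpace hcpt' τ')
      (_ : ∀ i, FiniteDimensional ℂ (Submodule.span ℂ (Set.range
        fun κ : (AutomorphyDatum.gl n K hcpt).arch.maximalCompact =>
          τ (toArch hcpt (κ : GL (Fin n) (mixedSpace K))) (e i : E))))
      (_ : ∀ i, FiniteDimensional ℂ (Submodule.span ℂ (Set.range
        fun κ : (AutomorphyDatum.gl m K hcpt').arch.maximalCompact =>
          τ' (toArch hcpt' (κ : GL (Fin m) (mixedSpace K))) (e' i : E'))))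
      (Λ h : ℂ → ℂ) (x₀ : ℝ), Differentiable ℂ Λ ∧ Differentiable ℂ h ∧ h s₀ ≠ 0 ∧ ∀ s : ℂ, x₀ < s.re →
        Λ s * ∑ i, archGapPairIntegralCplx hmn.le hcpt hcpt' τ hτ τ' hτ' ℓ ℓ' (e i) (e' i) μA μK s = h s := by
  obtain ⟨k, e, e', hfin, hfin', c, hc, d₁, d₂, a, b, g, x₀, hg, hg0, hΨ⟩ :=
    (h hmn hcpt hcpt' E τ hτ hτu hτi ℓ hℓ hℓ0 E' τ' hτ' hτu' hτi' ℓ' hℓ' hℓ'0 μA hμA μK hμK).1 s₀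
  refine ⟨k, e, e', hfin, hfin',
    fun s => (c : ℂ) ^ (-s) * ((∏ j, (Complex.Gammaℝ (s + a j))⁻¹) * ∏ j, (Complex.Gammaℂ (s + b j))⁻¹), g,
    max x₀ ((∑ j, ‖a j‖) + ∑ j, ‖b j‖), differentiable_archFactorInv hc.ne' a b, hg, hg0, fun s hs => ?_⟩
  obtain ⟨hs₀, hs₁⟩ := max_lt_iff.1 hs
  rw [hΨ s hs₀, mul_left_comm, archFactorInv_mul_eq_one hc a b hs₁, mul_one]

/-- **Registered sub-stub `stub_gap_arch_factor_data` (G-AFD) of `stub_gap_local_control` (G-LC)** — the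
archimedean `GL_n × GL_m` data at a prescribed point with their reciprocal entire factor `Λ`, in the registered
`∀`-closed form: `exists_archGapFactorData`.
[cite: JacquetArchimedeanRS2009, Thm. 2.1 (i)(ii) (p. 6), Thm. 2.6 (i) (p. 9), Prop. 12.5 (p. 75)]
[cite: CogdellAnalyticTheory2004, Thm. 3.5 (PDF p. 197) and §4.2 (PDF p. 202)] -/
theorem stub_gap_arch_factor_data :
    ∀ {n m : ℕ} {K : Type} [Field K] [NumberField K],
      JacquetShalika1990_archRankinSelbergGap_entireRatio n m K →
    ∀ (hmn : m < n) (hcpt : isCompact_glFiniteIntegralLevel n K) (hcpt' : isCompact_glFiniteIntegralLevel m K)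
      (E : Type) [NormedAddCommGroup E] [InnerProductSpace ℂ E] [CompleteSpace E]
      (τ : ContRepresentation ℂ (AutomorphyDatum.gl n K hcpt).arch.carrier E) (hτ : τ.IsStronglyContinuous)
      (_ : τ.IsUnitary) (_ : τ.IsTopIrreducible)
      (ℓ : archGardingSpace hcpt τ →ₗ[ℂ] ℂ) (_ : IsArchContWhittakerFunctional hcpt τ hτ ℓ) (_ : ℓ ≠ 0)
      (E' : Type) [NormedAddCommGroup E'] [InnerProductSpace ℂ E'] [CompleteSpace E']
      (τ' : ContRepresentation ℂ (AutomorphyDatum.gl m K hcpt').arch.carrier E') (hτ' : τ'.IsStronglyContinuous)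
      (_ : τ'.IsUnitary) (_ : τ'.IsTopIrreducible)
      (ℓ' : archGardingSpace hcpt' τ' →ₗ[ℂ] ℂ) (_ : IsArchContWhittakerFunctional hcpt' τ' hτ' ℓ') (_ : ℓ' ≠ 0)
      [MeasurableSpace (GL (Fin m) (mixedSpace K))] [BorelSpace (GL (Fin m) (mixedSpace K))]
      [MeasurableSpace ((mixedSpace K)ˣ)] [BorelSpace ((mixedSpace K)ˣ)]
      (μA : Measure (Fin m → (mixedSpace K)ˣ)) (_ : IsHaarMeasure μA)
      (μK : Measure ↥(Kinf m K)) (_ : IsHaarMeasure μK) (s₀ : ℂ),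
      ∃ (k : ℕ) (e : Fin k → archGardingSpace hcpt τ) (e' : Fin k → archGardingSpace hcpt' τ')
        (_ : ∀ i, FiniteDimensional ℂ (Submodule.span ℂ (Set.range
          fun κ : (AutomorphyDatum.gl n K hcpt).arch.maximalCompact =>
            τ (toArch hcpt (κ : GL (Fin n) (mixedSpace K))) (e i : E))))
        (_ : ∀ i, FiniteDimensional ℂ (Submodule.span ℂ (Set.range
          fun κ : (AutomorphyDatum.gl m K hcpt').arch.maximalCompact =>
            τ' (toArch hcpt' (κ : GL (Fin m) (mixedSpace K))) (e' i : E'))))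
        (Λ h : ℂ → ℂ) (x₀ : ℝ), Differentiable ℂ Λ ∧ Differentiable ℂ h ∧ h s₀ ≠ 0 ∧ ∀ s : ℂ, x₀ < s.re →
          Λ s * ∑ i, archGapPairIntegralCplx hmn.le hcpt hcpt' τ hτ τ' hτ' ℓ ℓ' (e i) (e' i) μA μK s = h s := by
  intro n m K _ _ h hmn hcpt hcpt' E _ _ _ τ hτ hτu hτi ℓ hℓ hℓ0 E' _ _ _ τ' hτ' hτu' hτi' ℓ' hℓ' hℓ'0 _ _ _ _
    μA hμA μK hμK s₀
  exact exists_archGapFactorData h hmn hcpt hcpt' E τ hτ hτu hτi ℓ hℓ hℓ0 E' τ' hτ' hτu' hτi' ℓ' hℓ' hℓ'0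
    μA hμA μK hμK s₀

end Summit.Langlands.Langlands.Theorems.GapArchFactorData

end
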